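import Literature.Barriers.AtomisticToContinuum.StrongPinningBreathersMinorization
import HarnessLib

/-!
# Hairer–Mattingly 2009, Theorem 5.6 (the Lyapunov function of the three-oscillator chain), named;
# the three-oscillator theorem assembled from it

Trunk T-KINETIC (`Literature/Barriers/AtomisticToContinuum`). The named fact
`HairerMattingly2009_threeOscillators` (`StrongPinningBreathers.lean`: the Langevin dynamics of the
three-oscillator Hairer–Mattingly chain with pinning `|q|^{2k}/2k`, `k > 3/2`, harmonic coupling,
friction `γ > 0` and temperatures `T_L, T_R > 0` has a transition semigroup with a unique invariant
probability measure) hit the literature-prover budget cap; 16 files landed, proving the semigroup,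
[HM09, Prop. 5.1] (Lyapunov drift ⟹ existence), the Hörmander-free local minorisation, LaSalle
irreducibility and Doeblin–Khasminskii uniqueness, and the reduction
`HairerMattingly2009_threeOscillators_of_thm56` (`StrongPinningBreathersMinorization`): the fact
follows from the PRINTED STATEMENT of [HM09, Theorem 5.6] alone, displayed there inline.

This file names that statement as the fact `HairerMattingly2009_threeOscillators_lyapunovFunction`
(M. Hairer, J. Mattingly, *Slow energy dissipation in anharmonic oscillator chains*, Comm. Pure
Appl. Math. 62 (2009), Thm. 5.6: for the three-oscillator chain there is a `C²` function `𝒱` with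
`𝒱 ≥ c H^α − C` and `L𝒱 ≤ C − c H^{α'}`, `α = 3/2 − 1/(2k) − ε`, `α' = 1/2 − 3/(2k) − ε'`, built in
§§3–5 from the scaling of the free oscillator, averaging over its fast periodic motion and explicit
correctors) and PROVES `HairerMattingly2009_threeOscillators_holds_of` from it. The child is a
Lyapunov-function existence statement — an intermediate result of the printed proof, not a
restatement of the parent (which speaks of invariant measures).

## References

* [HairerMattingly2009] M. Hairer, J. C. Mattingly, Slow energy dissipation in anharmonic
  oscillator chains, Comm. Pure Appl. Math. 62 (2009) 999–1032, §1, Prop. 5.1, Thm. 5.6.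
-/

noncomputable section

open MeasureTheory

namespace Literature.Barriers.AtomisticToContinuum

open Literature.MathematicalPhysics.KineticTheory Literature.MathematicalPhysics.KineticTheory.HeatConduction
open Literature.Barriers.AtomisticToContinuum.HeatConduction

/-- **Hairer–Mattingly 2009, Theorem 5.6 (the Lyapunov function).** For every `k > 3/2`, `γ > 0`
and `T_L, T_R > 0`, the three-oscillator Hairer–Mattingly chain (`homogeneouslyPinnedChain k γ`,
`N = 3`) admits a `C²` function `𝒱 : PhaseSpace 3 → ℝ` and constants `c, C, α, α' > 0` with
`𝒱(x) ≥ c H(x)^α − C` and `(L𝒱)(x) ≤ C − c H(x)^{α'}` for all `x`, `H` the Hamiltonian and `L` the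
generator of the Langevin dynamics (printed with `α = 3/2 − 1/(2k) − ε`, `α' = 1/2 − 3/(2k) − ε'`;
here the exponents are quantified existentially, which is all that [HM09, Prop. 5.1] and the
uniqueness argument consume). Verbatim the hypothesis `h56` of
`HairerMattingly2009_threeOscillators_of_thm56`. [cite: HairerMattingly2009, Thm 5.6] -/
def HairerMattingly2009_threeOscillators_lyapunovFunction : Prop :=
  ∀ k γ : ℝ, 3 / 2 < k → 0 < γ → ∀ T_L T_R : ℝ, 0 < T_L → 0 < T_R →
    ∃ (𝒱 : PhaseSpace 3 → ℝ) (c C α α' : ℝ), ContDiff ℝ 2 𝒱 ∧ 0 < c ∧ 0 < C ∧ 0 < α ∧ 0 < α' ∧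
      (∀ x, c * (homogeneouslyPinnedChain k γ).hamiltonian 3 x ^ α - C ≤ 𝒱 x) ∧
      (∀ x, (homogeneouslyPinnedChain k γ).generator 3 T_L T_R 𝒱 x ≤
        C - c * (homogeneouslyPinnedChain k γ).hamiltonian 3 x ^ α')

/-- **Assembly: the three-oscillator theorem of [HM09] from Theorem 5.6.**
`HairerMattingly2009_threeOscillators_lyapunovFunction → HairerMattingly2009_threeOscillators`, by
`HairerMattingly2009_threeOscillators_of_thm56` (Prop. 5.1, the local minorisation, irreducibility
and uniqueness being theorems of the tree). [cite: HairerMattingly2009, §1 and Prop 5.1 and Thm 5.6] -/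
theorem HairerMattingly2009_threeOscillators_holds_of
    (h : HairerMattingly2009_threeOscillators_lyapunovFunction) :
    HairerMattingly2009_threeOscillators :=
  HairerMattingly2009_threeOscillators_of_thm56 h

end Literature.Barriers.AtomisticToContinuum

end
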